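import Literature.NumberTheory.EllipticCurves.QuadraticTwist
import Summits.BirchSwinnertonDyer.Rank1Residual.X1.RankZeroDoubleTwistTransport
import HarnessLib

/-!
# bsd-eis-idea g17 — CONE-CLOSURE lens memo, typed by-products
(crux `stmt-BirchSwinnertonDyer-19035`, decl
`Summit.BirchSwinnertonDyer.BirchSwinnertonDyer.Theses.EisensteinPrimes.MazurMCOnX1RankZero`)

This seat files NO crux idea card (every lever examined reduces to the cone of the 17 filed cards +
HOME memos, see `Ideas/cone-closure-g17-lens-memo.md`). Typed here, all `def … : Prop`, no axioms,
no `sorry`, so that refuters / the planner-of-record can point at exact statements: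

* `HeegnerTwistTamagawaRigidity p`, `TwistTorsionPrimeToP p` — SUPPORT-grade bookkeeping for road
  (B-ii) (double twist): along a twist by `d` in which every bad prime SPLITS, the `p`-part of the
  Tamagawa product is unchanged and the twist has no rational `p`-torsion (elementary: local
  isomorphism at the bad primes, `c_ℓ ∈ {1,2,4}` at `ℓ ∣ d`, `E^{(d)}[p]^{ss} = ε_d ⊕ ωε_d`).
  Desk check (g9 table `idea-g9/fals/halving.tsv`, 414 rows, p = 3, DEFINITE companions): the
  one-sided consequence `v₃ ∏c(companion) ≥ v₃ ∏_{ℓ split} c_ℓ(E*)` holds 414/414, torsion of the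
  companion is 3-free 414/414; the equality case needs a Tamagawa column for the 126 double-twist
  displays (data ask `bsd-frontier-data`).
* `DefiniteCompanionForcedP p` — the NAIVE «forced p» law (Vatsal-type first-layer Eisenstein
  congruence read in Néron–BSD currency on a definite companion). **REFUTED by the census**:
  161/336 rank-0 companions have `v₃(#Ш·∏c/#T²) = 0` (first witness `14a4`, `d = −71`, companion
  `70574e3`). Typed so that a refuter may land `¬ DefiniteCompanionForcedP 3` by certificate.
* `RealTwistUnitSupply p` — the sharpened SEARCH QUESTION behind the rider
  `RankZeroDoubleTwistTransport.DoubleTwistCertificateSupply`: ONE real quadratic twist `D > 1`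
  (no splitting conditions) with a `p`-unit `#Ш_an` at some member. Census (k5-c5
  `rtw_table_N1pp_all.md`, p = 3): 92/100 classes certified, 8 undetermined inside the search box,
  `min ord₃ #Ш_an ∈ {0: 92, 2: 28, 4: 7}` (all even).
* `SteeringThesis p` — the typed content of the (not carded) half-integral-weight engine:
  one unit real twist anywhere ⇒ an ADMISSIBLE double-twist certificate (Bruinier / Ono–Skinner
  non-vanishing mod `p` of weight-3/2 coefficients with prescribed quadratic-residue conditions,
  applied to `g_E^+ | U_{|d_K|}`; theta-type alternative excluded at `ψ = 1` by nebentypus parity).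
  Two sub-steps have no named tool (content non-degeneration along BFH rays; the first unit twist),
  which is why it is a memo §5 note and not a card.
-/

set_option linter.dupNamespace false
set_option autoImplicit false

noncomputable section

open scoped Classical
open WeierstrassCurve NumberField Literature.NumberTheory.EllipticCurves
open Literature.NumberTheory.EllipticCurves.Rank1Residual
open Summit.BirchSwinnertonDyer.Rank1Residual.X1
open Summit.BirchSwinnertonDyer.Rank1Residual.X1.RankZeroDoubleTwist (DoubleTwistPartnerAt)

namespace Summit.BirchSwinnertonDyer.BirchSwinnertonDyer.Cruxes.MazurMCOnX1RankZero.ConeClosureG17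


/-! ### Vocabulary (copied verbatim from g9's `DefiniteSquareLawSketch.lean`, which is a crux
workfile and not built on the farm; same names, this namespace) -/

/-- The rank-0 algebraic `L`-value of a (globally minimal) model: `L(W,1)/Ω_W = q ∈ ℚ`. -/
def IsLalg (W : WeierstrassCurve ℚ) [W.IsElliptic] (q : ℚ) : Prop :=
  W.entireLFunction 1 / (W.realPeriodRat : ℂ) = (q : ℂ)

/-- Bad primes of a globally minimal model = prime support of the minimal discriminant. -/
def badPrimes (W : WeierstrassCurve ℚ) : Finset ℕ := (W.Δ).num.natAbs.primeFactors

/-- Number of bad primes of `W` inert in `ℚ(√d)` (g9's convention). -/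
def inertCount (W : WeierstrassCurve ℚ) (d : ℤ) : ℕ :=
  ((badPrimes W).filter fun ℓ => jacobiSym d ℓ = -1).card

/-- g9's DEFINITE admissibility: `d < 0` squarefree, `p ∤ d`, `d` coprime to the minimal
discriminant, odd number of bad primes inert in `ℚ(√d)`. -/
def Admissible (W : WeierstrassCurve ℚ) (p : ℕ) (d : ℤ) : Prop :=
  d < 0 ∧ Squarefree d ∧ ¬ ((p : ℤ) ∣ d) ∧ Int.gcd d (W.Δ).num = 1 ∧ Odd (inertCount W d)

/-- `Wd` is (a model of) the quadratic twist `W^{(d)}`. -/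
def IsCompanion (W : WeierstrassCurve ℚ) (d : ℤ) (Wd : WeierstrassCurve ℚ) : Prop :=
  ∃ C : WeierstrassCurve.VariableChange ℚ, C • Wd = W.quadraticTwist (d : ℚ)

/-- `ℓ` splits in `ℚ(√d)`, Kronecker form (`ℓ = 2`: `d ≡ 1 (mod 8)`; odd `ℓ`: `(d/ℓ) = 1`). -/
def SplitsIn (d : ℤ) (ℓ : ℕ) : Prop := if ℓ = 2 then d % 8 = 1 else jacobiSym d ℓ = 1

/-- **T1 (support, road B-ii bookkeeping).** Along a quadratic twist by a squarefree `d` coprime to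
the minimal discriminant in which EVERY bad prime of `W` splits (the Heegner shape of admissibility),
the `p`-adic valuation of the Tamagawa product is unchanged (`p` odd): `E^{(d)} ≅ E` over `ℚ_ℓ` at
each bad `ℓ`, and `c_ℓ(E^{(d)}) ∈ {1, 2, 4}` at `ℓ ∣ d`. Desk check: one-sided consequence 414/414 on
the definite census (split primes only); equality case = data ask. [folklore: Tate's algorithm] -/
def HeegnerTwistTamagawaRigidity (p : ℕ) [Fact p.Prime] : Prop :=
  ∀ (W : WeierstrassCurve ℚ) [W.IsElliptic] [W.IsGloballyMinimal] (d : ℤ)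
    (Wd : WeierstrassCurve ℚ) [Wd.IsElliptic] [Wd.IsGloballyMinimal],
    2 < p → d ≠ 0 → Squarefree d → ¬ ((p : ℤ) ∣ d) → Int.gcd d (W.Δ).num = 1 →
    (∀ ℓ ∈ badPrimes W, SplitsIn d ℓ) → IsCompanion W d Wd →
    padicValNat p Wd.tamagawaProduct = padicValNat p W.tamagawaProduct

/-- **T1b (support).** A nontrivial squarefree twist (`d ≠ 1`, `p ∤ d`, `p` odd) of a curve with a
rational point of order `p` has NO rational `p`-torsion: `E^{(d)}[p]^{ss} = ε_d ⊕ ω ε_d` with both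
characters nontrivial (`ω ε_d = 1` only for `p = 3, d = −3`, excluded by `p ∤ d`). Census: companion
torsion 3-free in 414/414 rows. [folklore] -/
def TwistTorsionPrimeToP (p : ℕ) [Fact p.Prime] : Prop :=
  ∀ (W : WeierstrassCurve ℚ) [W.IsElliptic] [W.IsGloballyMinimal] (d : ℤ)
    (Wd : WeierstrassCurve ℚ) [Wd.IsElliptic] [Wd.IsGloballyMinimal],
    2 < p → (p : ℕ) ∣ W.torsionOrder → d ≠ 1 → Squarefree d → ¬ ((p : ℤ) ∣ d) →
    IsCompanion W d Wd → ¬ ((p : ℕ) ∣ Wd.torsionOrder)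

/-- **T2 — REFUTED BY CENSUS (typed for the record).** The naive «forced `p`» law: on a DEFINITE
admissible companion `W^{(d)}` (g9's `Admissible`: `d < 0`, odd number of bad primes inert) of a
rank-0 X1 curve with rational `p`-torsion, the rank-0 BSD quotient `L(W^{(d)},1)/Ω = #Ш_an·∏c/#T²`
would be divisible by `p` (first-layer Eisenstein vanishing `B_{1,ε_d}·B_{1,ε_d ω⁻¹} = 0` read in
Néron currency). Desk falsifier (g9 `halving.tsv`, sha16 a73f14faf35846b2, p = 3, 336 rank-0
companions): `v₃ ∈ {0: 161, 1: 92, 2: 68, 3: 15}` — 161 counterexamples, first `14a4`, `d = −71`,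
companion `70574e3` (`#Ш = 1`, `∏c` and `#T` 3-free). The forced `p` lives in Vatsal's CANONICAL
period, not in `#Ш·∏c/#T²`. [cite: Vatsal1999, Thm. 1.x (canonical periods)] -/
def DefiniteCompanionForcedP (p : ℕ) [Fact p.Prime] : Prop :=
  ∀ (W : WeierstrassCurve ℚ) [W.IsElliptic] [W.IsGloballyMinimal],
    ClassX1 W p → W.analyticRank = 0 → (p : ℕ) ∣ W.torsionOrder →
    ∀ (d : ℤ) (Wd : WeierstrassCurve ℚ) [Wd.IsElliptic] [Wd.IsGloballyMinimal],
      Admissible W p d → IsCompanion W d Wd → Wd.analyticRank = 0 →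
      ∀ q : ℚ, IsLalg Wd q → 1 ≤ padicValRat p q

/-- **T3 — the sharpened search question (K-one of memo §5).** Every rank-0 X1 pair has ONE real
quadratic twist `D > 1` (squarefree, `p ∤ D`, coprime to the minimal discriminant — NO splitting
conditions) of analytic rank 0 whose isogeny class contains a member with `p`-unit `#Ш_an`.
Census (k5-c5 `rtw_table_N1pp_all.md`, p = 3, even the ADMISSIBLE sub-family): 92/100 classes
certified, 8 undetermined in the box `N·D² < cap`; `min ord₃ #Ш_an` over the twisted class always
even. Not in print class-wide (nearest: Ono–Skinner 1998 / Bruinier 1999 give it for all but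
finitely many UNSPECIFIED `p` per curve). -/
def RealTwistUnitSupply (p : ℕ) [Fact p.Prime] : Prop :=
  ∀ (W : WeierstrassCurve ℚ) [W.IsElliptic] [W.IsGloballyMinimal],
    ClassX1 W p → W.analyticRank = 0 →
    ∃ D : ℤ, 1 < D ∧ Squarefree D ∧ ¬ ((p : ℤ) ∣ D) ∧ Int.gcd D (W.Δ).num = 1 ∧
      ∃ (Wd : WeierstrassCurve ℚ) (_ : Wd.IsElliptic) (_ : Wd.IsGloballyMinimal),
        IsCompanion W D Wd ∧ Wd.analyticRank = 0 ∧
        ∃ (Wc : WeierstrassCurve ℚ) (_ : Wc.IsElliptic) (_ : Wc.IsGloballyMinimal),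
          IsIsogenous Wd Wc ∧ ∃ q : ℚ, shaAn Wc = (q : ℂ) ∧ padicValRat p q = 0


/-- **T3∞ — theta-exclusion in arithmetic currency (memo §5, the residual statement of the
half-integral-weight engine at an Eisenstein prime).** INFINITELY many real quadratic twists as in
`RealTwistUnitSupply`. By Waldspurger/Kohnen–Baruch–Mao + BSD bookkeeping this is the shadow of «the
weight-3/2 lift `g_E` reduced mod `p` (content removed) is NOT supported on finitely many square
classes» — the alternative that Bruinier–Ono–Skinner-type theorems cannot exclude here, because at an
Eisenstein `p` the Hecke eigenvalues `a_ℓ ≡ 1 + ℓ` ARE the theta-type eigenvalues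
[corpus: paper:doi-10-1016-s0022-314x-02-00061-6, Thm. 1(2) p. 2]. Census: as for T3 (finite box,
cannot witness infinitude; 35/127 admissible rows non-unit, all with even exponent). -/
def RealTwistUnitSupplyInfinite (p : ℕ) [Fact p.Prime] : Prop :=
  ∀ (W : WeierstrassCurve ℚ) [W.IsElliptic] [W.IsGloballyMinimal],
    ClassX1 W p → W.analyticRank = 0 → ∀ B : ℤ,
    ∃ D : ℤ, B < D ∧ 1 < D ∧ Squarefree D ∧ ¬ ((p : ℤ) ∣ D) ∧ Int.gcd D (W.Δ).num = 1 ∧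
      ∃ (Wd : WeierstrassCurve ℚ) (_ : Wd.IsElliptic) (_ : Wd.IsGloballyMinimal),
        IsCompanion W D Wd ∧ Wd.analyticRank = 0 ∧
        ∃ (Wc : WeierstrassCurve ℚ) (_ : Wc.IsElliptic) (_ : Wc.IsGloballyMinimal),
          IsIsogenous Wd Wc ∧ ∃ q : ℚ, shaAn Wc = (q : ℂ) ∧ padicValRat p q = 0

/-- T3∞ ⇒ T3 (bookkeeping, proved). -/
theorem realTwistUnitSupply_of_infinite (p : ℕ) [Fact p.Prime]
    (h : RealTwistUnitSupplyInfinite p) : RealTwistUnitSupply p := by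
  intro W _ _ hX hr
  obtain ⟨D, -, hD⟩ := h W hX hr 0
  exact ⟨D, hD⟩

/-- **T4 — STEERING THESIS (typed content of the un-carded engine, memo §5).** One unit real twist
anywhere (T3) ⇒ an ADMISSIBLE double-twist certificate at every rank-0 leaf pair, i.e. the rider
`DoubleTwistCertificateSupply` pair by pair. Proposed mechanism: Bruinier / Ono–Skinner steering of
unit weight-3/2 coefficients into prescribed residue classes, applied to `g_E^+ | U_{|d_K|}` for a
Bump–Friedberg–Hoffstein `d_K`; theta alternative excluded at `ψ = 1`. Open sub-steps without a named
tool: content non-degeneration of `g_E^+ | U_{|d_K|}` for some BFH-good `d_K`. -/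
def SteeringThesis (p : ℕ) [Fact p.Prime] : Prop :=
  RealTwistUnitSupplyInfinite p →
    ∀ (V : WeierstrassCurve ℚ) [V.IsElliptic] [V.IsGloballyMinimal],
      RankZero.Leaf V p → DoubleTwistPartnerAt V p

end Summit.BirchSwinnertonDyer.BirchSwinnertonDyer.Cruxes.MazurMCOnX1RankZero.ConeClosureG17

end
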